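import Summits.Ventures.HodgeRepro2.T7SupportBergmanOneVectorMonomial

/-!
# The `K`-type `n = 1`: the expansion of `π_k(h⁻¹) z` and the vanishing locus of `hq` (support, seat p1)

For `g = h⁻¹ = su11 A B` (`A = a(h⁻¹)`, `B = b(h⁻¹)`) the translated first `K`-type is
  `(π_k(g) z)(w) = (A − B̄ w)^{−k} · (Ā w − B)/(A − B̄ w) = A^{−(k+1)} K^{(k+1)}_{g·0}(w) · (Ā w − B)`
(`act_id_eq`; `K^{(k+1)}_z` the weight-`(k+1)` kernel of `T5BergmanKernel`, `g·0 = B/Ā`), hence on the disc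
  `π_k(g) z = Σ_m c_m wᵐ`,  `c_0 = −B A^{−(k+1)}`,  `c_{m+1} = A^{−(k+1)} (Ā d_m − B d_{m+1})`,  `d_j = C(j+k, j) conj(g·0)^j`
(`weightOneCoeff`, `hasSum_act_id`). With `T7SupportBergmanOneVectorMonomial` this gives, for the line's `u_A = z`
(the `K`-type `(5/2, −5/2)` of the weight-3 series `π⁰_triv`, L3-ARGUMENT §4a l. 47):
  `Φ_{−(k+2m)}(γ) = c_m ⟨π_k(γ h) zᵐ, z⟩_k`, `Φ_{−(k+2m)}(1) = |c_m|² ⟨zᵐ, zᵐ⟩_k`, **`hq ⟺ c_m ≠ 0`**,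
and the VANISHING LOCUS is computed: `c_0 ≠ 0 ⟺ h ∉ K` (`weightOneCoeff_zero_ne_zero_iff`) and, for `h ∉ K`,
  **`c_{m+1} = 0 ⟺ |b(h)|² · k = m + 1`**   (`weightOneCoeff_succ_eq_zero_iff`: `Ā d_m − B d_{m+1} =
  conj(g·0)^m A⁻¹ (|A|² C(m+k, m) − |B|² C(m+k+1, m+1))`, `|A|² = 1 + |B|²`, `C(m+k+1, m+1) (m+1) = C(m+k, m) (m+k+1)`).
So, unlike the lowest `K`-type (row 701: `hq` for every `q` as soon as `h ∉ K`), for `u_A = z` the hypothesis `hq_v`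
at the `K`-type `m + 1` FAILS on the real-codimension-one locus `|b(h_v)|² = (m+1)/k` — for `π⁰_triv` with `m = 1`
(`u_B` of the same `K`-type), exactly when `|b(h_v)|² = 1/3` (`hq_weightOne_iff`): a condition on the datum `h_v`.

Explicit model only; nothing about the adelic group, the global invariant, or any period.
Blind lane: Mathlib + the HodgeRepro2 prefix only; no sorry; axioms ⊆ {propext, Classical.choice, Quot.sound}.
-/

namespace Summit.Ventures.HodgeRepro2.T7SupportBergmanOneVectorWeightOne

open MeasureTheory Metric
open T5PoincareDensity T5SU11Unimodular T5SU11Fibration T5BergmanCoefficient T5BergmanMatrixCoeff T5HaarCircle T5BergmanActStable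
  T5BergmanKernel T5BergmanParseval T5BergmanFourier T5BergmanUnitary T5BergmanCoefficientL2 T5BergmanCoeffOrtho
  T7SupportTwoTorusInvariant T7SupportKappaCartan T7SupportCartanShift T7SupportBergmanOneVectorFourier
  T7SupportBergmanOneVectorMonomial

/-- **`(π_k(g) z)(w) = A^{−(k+1)} K^{(k+1)}_{g·0}(w) (Ā w − B)`** -/
theorem act_id_eq (k : ℕ) (g : SU11) {w : ℂ} (hw : w ∈ ball (0 : ℂ) 1) :
    act k g (fun z => z ^ 1) w =
      (mat g 0 0)⁻¹ ^ (k + 1) * kernel (k + 1) (orbit g) w *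
        ((starRingEnd ℂ) (mat g 0 0) * w - mat g 0 1) := by
  have hd : denom (mat g⁻¹) w ≠ 0 := denom_inv_ne_zero g (ball_subset_closedBall hw)
  have e1 : act k g (fun z => z ^ 1) w =
      (denom (mat g⁻¹) w)⁻¹ ^ (k + 1) * ((starRingEnd ℂ) (mat g 0 0) * w - mat g 0 1) := by
    unfold act
    rw [mobius_inv_eq]
    simp only [pow_one]
    rw [pow_succ]
    field_simp
    ring
  have e2 : (denom (mat g⁻¹) w)⁻¹ ^ (k + 1) = (mat g 0 0)⁻¹ ^ (k + 1) * kernel (k + 1) (orbit g) w := by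
    rw [← act_lowest_apply (k + 1) g w, act_lowest_eq_kernel]
  rw [e1, e2]

/-- the kernel coefficients of weight `k + 1` at `g·0`, shifted by one: `d_{m−1}` (`0` for `m = 0`) -/
noncomputable def prevCoeff (k : ℕ) (g : SU11) (m : ℕ) : ℂ :=
  if m = 0 then 0 else kernelCoeff (k + 1) (orbit g) (m - 1)

/-- **the Taylor coefficients of `π_k(g) z`**: `c_m = A^{−(k+1)} (Ā d_{m−1} − B d_m)` -/
noncomputable def weightOneCoeff (k : ℕ) (g : SU11) (m : ℕ) : ℂ :=
  (mat g 0 0)⁻¹ ^ (k + 1) *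
    ((starRingEnd ℂ) (mat g 0 0) * prevCoeff k g m - mat g 0 1 * kernelCoeff (k + 1) (orbit g) m)

/-- `c_0 = −B A^{−(k+1)}` -/
theorem weightOneCoeff_zero (k : ℕ) (g : SU11) :
    weightOneCoeff k g 0 = -(mat g 0 1) * (mat g 0 0)⁻¹ ^ (k + 1) := by
  unfold weightOneCoeff prevCoeff kernelCoeff
  simp
  ring

/-- `c_{m+1} = A^{−(k+1)} (Ā d_m − B d_{m+1})` -/
theorem weightOneCoeff_succ (k : ℕ) (g : SU11) (m : ℕ) :
    weightOneCoeff k g (m + 1) =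
      (mat g 0 0)⁻¹ ^ (k + 1) *
        ((starRingEnd ℂ) (mat g 0 0) * kernelCoeff (k + 1) (orbit g) m -
          mat g 0 1 * kernelCoeff (k + 1) (orbit g) (m + 1)) := by
  unfold weightOneCoeff prevCoeff
  simp

/-- **`π_k(g) z = Σ_m c_m wᵐ` on the disc** -/
theorem hasSum_act_id (k : ℕ) (hk : 2 ≤ k) (g : SU11) {w : ℂ} (hw : w ∈ ball (0 : ℂ) 1) :
    HasSum (fun m => weightOneCoeff k g m * w ^ m) (act k g (fun z => z ^ 1) w) := by
  rw [act_id_eq k g hw]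
  set d : ℕ → ℂ := kernelCoeff (k + 1) (orbit g) with hd
  set S : ℂ := kernel (k + 1) (orbit g) w with hS
  have hK : HasSum (fun j => d j * w ^ j) S := hasSum_kernel (k + 1) (by omega) (orbit_mem_ball g) hw
  -- the two pieces: `B Σ d_j w^j` and `Ā w Σ d_j w^j = Σ Ā d_{m−1} w^m`
  have h1 : HasSum (fun j => mat g 0 1 * d j * w ^ j) (mat g 0 1 * S) := by
    refine (hK.mul_left (mat g 0 1)).congr_fun fun j => ?_
    ring
  have h2 : HasSum (fun m => (starRingEnd ℂ) (mat g 0 0) * prevCoeff k g m * w ^ m)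
      ((starRingEnd ℂ) (mat g 0 0) * w * S) := by
    have h2' : HasSum (fun j => (starRingEnd ℂ) (mat g 0 0) * prevCoeff k g (j + 1) * w ^ (j + 1))
        ((starRingEnd ℂ) (mat g 0 0) * w * S) := by
      refine (hK.mul_left ((starRingEnd ℂ) (mat g 0 0) * w)).congr_fun fun j => ?_
      simp only [prevCoeff, Nat.succ_ne_zero, if_false, Nat.add_sub_cancel, hd]
      ring
    have h0 : prevCoeff k g 0 = 0 := by simp [prevCoeff]
    refine (hasSum_nat_add_iff' (f := fun m => (starRingEnd ℂ) (mat g 0 0) * prevCoeff k g m * w ^ m) 1).mp ?_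
    rw [Finset.sum_range_one]
    simp only [h0, mul_zero, zero_mul, sub_zero]
    exact h2'
  have h3 := (h2.sub h1).mul_left ((mat g 0 0)⁻¹ ^ (k + 1))
  have e : (mat g 0 0)⁻¹ ^ (k + 1) * ((starRingEnd ℂ) (mat g 0 0) * w * S - mat g 0 1 * S) =
      (mat g 0 0)⁻¹ ^ (k + 1) * S * ((starRingEnd ℂ) (mat g 0 0) * w - mat g 0 1) := by ring
  rw [← e]
  refine h3.congr_fun fun m => ?_
  unfold weightOneCoeff
  ring

/-- `c_0 ≠ 0 ⟺ B ≠ 0 ⟺ h ∉ K` -/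
theorem weightOneCoeff_zero_ne_zero_iff (k : ℕ) (g : SU11) :
    weightOneCoeff k g 0 ≠ 0 ↔ mat g 0 1 ≠ 0 := by
  rw [weightOneCoeff_zero]
  have hA : (mat g 0 0)⁻¹ ^ (k + 1) ≠ 0 := pow_ne_zero _ (inv_ne_zero (mat_zero_zero_ne_zero g))
  constructor
  · intro h hB
    exact h (by rw [hB, neg_zero, zero_mul])
  · intro hB
    exact mul_ne_zero (neg_ne_zero.2 hB) hA

/-- the bracket `Ā d_m − B d_{m+1}` factorised: `conj(g·0)^m A⁻¹ (|A|² C(m+k, m) − |B|² C(m+k+1, m+1))` -/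
theorem bracket_eq (k : ℕ) (g : SU11) (m : ℕ) :
    (starRingEnd ℂ) (mat g 0 0) * kernelCoeff (k + 1) (orbit g) m -
        mat g 0 1 * kernelCoeff (k + 1) (orbit g) (m + 1) =
      ((starRingEnd ℂ) (orbit g)) ^ m * (mat g 0 0)⁻¹ *
        ((Complex.normSq (mat g 0 0) * ((m + (k + 1) - 1).choose m : ℕ) -
          Complex.normSq (mat g 0 1) * ((m + 1 + (k + 1) - 1).choose (m + 1) : ℕ) : ℝ) : ℂ) := by
  have hA : mat g 0 0 ≠ 0 := mat_zero_zero_ne_zero g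
  have horb : (starRingEnd ℂ) (orbit g) = (starRingEnd ℂ) (mat g 0 1) / mat g 0 0 := by
    rw [orbit_eq, map_div₀, Complex.conj_conj]
  unfold kernelCoeff
  rw [horb, Complex.ofReal_sub, Complex.ofReal_mul, Complex.ofReal_mul, Complex.ofReal_natCast,
    Complex.ofReal_natCast, Complex.normSq_eq_conj_mul_self, Complex.normSq_eq_conj_mul_self, pow_succ]
  field_simp

/-- `|A|² = 1 + |B|²` on `SU(1,1)` -/
theorem normSq_zero_zero_eq (g : SU11) :
    Complex.normSq (mat g 0 0) = 1 + Complex.normSq (mat g 0 1) := by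
  have := T5SU11Fibration.normSq_sub_normSq g
  linarith

/-- the binomial identity `C(m+k+1, m+1) (m+1) = C(m+k, m) (m+k+1)` -/
theorem choose_succ_mul (k m : ℕ) :
    ((m + 1 + (k + 1) - 1).choose (m + 1) : ℝ) * (m + 1) = ((m + (k + 1) - 1).choose m : ℝ) * (m + k + 1) := by
  have h := Nat.add_one_mul_choose_eq (m + k) m
  have e1 : m + 1 + (k + 1) - 1 = m + k + 1 := by omega
  have e2 : m + (k + 1) - 1 = m + k := by omega
  rw [e1, e2]
  have h' : (m + k + 1).choose (m + 1) * (m + 1) = (m + k).choose m * (m + k + 1) := by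
    rw [← h]
    ring
  exact_mod_cast h'

/-- **the vanishing locus of `c_{m+1}`** (for `h ∉ K`): `c_{m+1} = 0 ⟺ |b(h)|² · k = m + 1` -/
theorem weightOneCoeff_succ_eq_zero_iff (k : ℕ) (g : SU11) (hB : mat g 0 1 ≠ 0) (m : ℕ) :
    weightOneCoeff k g (m + 1) = 0 ↔ Complex.normSq (mat g 0 1) * k = m + 1 := by
  have hA : mat g 0 0 ≠ 0 := mat_zero_zero_ne_zero g
  have horb : orbit g ≠ 0 := by
    rw [orbit_eq]
    exact div_ne_zero hB ((map_ne_zero _).2 hA)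
  rw [weightOneCoeff_succ, bracket_eq]
  have hnz : (mat g 0 0)⁻¹ ^ (k + 1) * ((starRingEnd ℂ) (orbit g) ^ m * (mat g 0 0)⁻¹) ≠ 0 :=
    mul_ne_zero (pow_ne_zero _ (inv_ne_zero hA))
      (mul_ne_zero (pow_ne_zero _ ((map_ne_zero _).2 horb)) (inv_ne_zero hA))
  rw [← mul_assoc, mul_eq_zero, or_iff_right hnz, Complex.ofReal_eq_zero, sub_eq_zero, normSq_zero_zero_eq]
  -- the real identity: `(1 + |B|²) N = |B|² N (m+k+1)/(m+1)` with `N = C(m+k, m) > 0`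
  have hN : (0 : ℝ) < ((m + (k + 1) - 1).choose m : ℝ) := by
    have : 0 < (m + (k + 1) - 1).choose m := Nat.choose_pos (by omega)
    exact_mod_cast this
  have hb := choose_succ_mul k m
  set N : ℝ := ((m + (k + 1) - 1).choose m : ℝ) with hNdef
  set N' : ℝ := ((m + 1 + (k + 1) - 1).choose (m + 1) : ℝ) with hN'def
  set b2 : ℝ := Complex.normSq (mat g 0 1) with hb2
  constructor
  · intro h
    -- (1 + b2) N = b2 N' ; N' (m+1) = N (m+k+1)  ⇒  (1 + b2)(m+1) = b2 (m+k+1) ⇒ b2 k = m + 1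
    have h' : (1 + b2) * N * (m + 1) = b2 * (N' * (m + 1)) := by linear_combination (m + 1 : ℝ) * h
    rw [hb] at h'
    have : N * ((1 + b2) * (m + 1) - b2 * (m + k + 1)) = 0 := by linear_combination h'
    rcases mul_eq_zero.1 this with h0 | h0
    · exact absurd h0 hN.ne'
    · linear_combination (-1 : ℝ) * h0
  · intro h
    have hm1 : (0 : ℝ) < m + 1 := by positivity
    have : ((1 + b2) * N - b2 * N') * (m + 1) = 0 := by
      linear_combination (-N) * h - b2 * hb
    rcases mul_eq_zero.1 this with h0 | h0
    · exact sub_eq_zero.1 h0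
    · exact absurd h0 hm1.ne'

variable [MeasurableSpace Circle] [BorelSpace Circle]

/-- **`Φ_{−(k+2m)}(γ) = c_m ⟨π_k(γ h) zᵐ, z⟩_k`** for `u_A = z` -/
theorem monomialFourierCoeff_one_eq (k : ℕ) (hk : 2 ≤ k) (h : SU11) (m : ℕ) (γ : SU11) :
    monomialFourierCoeff k 1 h (-((k + 2 * m : ℕ) : ℤ)) γ =
      weightOneCoeff k h⁻¹ m * matrixCoeff k (fun w => w ^ m) (fun z => z ^ 1) (γ * h) :=
  monomialFourierCoeff_eq k hk 1 h (weightOneCoeff k h⁻¹) (fun _ hz => hasSum_act_id k hk h⁻¹ hz) m γ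

/-- **`hq` for `u_A = z` at the `K`-type `q = −(k+2m)` is `c_m(h⁻¹) ≠ 0`** -/
theorem hq_weightOne_iff (k : ℕ) (hk : 2 ≤ k) (h : SU11) (m : ℕ) :
    monomialFourierCoeff k 1 h (-((k + 2 * m : ℕ) : ℤ)) 1 ≠ 0 ↔ weightOneCoeff k h⁻¹ m ≠ 0 :=
  monomialFourierCoeff_one_ne_zero_iff k hk 1 h (weightOneCoeff k h⁻¹) (fun _ hz => hasSum_act_id k hk h⁻¹ hz) m

/-- **the line's case**: for `h ∉ K`, `hq` at the `K`-type `q = −(k + 2(m+1))` holds iff `|b(h)|² k ≠ m + 1` —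
for `π⁰_triv` (`k = 3`, `u_B` of the `K`-type `m + 1 = 1`) iff `|b(h)|² ≠ 1/3` -/
theorem hq_weightOne_succ_iff (k : ℕ) (hk : 2 ≤ k) (h : SU11) (hB : mat h 0 1 ≠ 0) (m : ℕ) :
    monomialFourierCoeff k 1 h (-((k + 2 * (m + 1) : ℕ) : ℤ)) 1 ≠ 0 ↔
      Complex.normSq (mat h 0 1) * k ≠ m + 1 := by
  rw [hq_weightOne_iff k hk h (m + 1), Ne, weightOneCoeff_succ_eq_zero_iff k h⁻¹ ?_ m,
    T5BergmanActStable.mat_inv_zero_one, Complex.normSq_neg]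
  rw [T5BergmanActStable.mat_inv_zero_one]
  exact neg_ne_zero.2 hB

end Summit.Ventures.HodgeRepro2.T7SupportBergmanOneVectorWeightOne
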